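import Literature.AlgebraicGeometry.Resolution.DecompletionPolydiscLambda
import Literature.AlgebraicGeometry.Resolution.DecompletionBridgeCoordinate
import HarnessLib

/-!
# Temkin's decompletion lemma, algebraic proof — XII. `θ : m° → D₁`, the roof `D₂`, and the bridge map `Λ′ : E₁ → D₂`

Topic: `Literature/AlgebraicGeometry/Resolution`. M. Temkin, *Inseparable local uniformization*,
J. Algebra 373 (2013) 65–119 = arXiv:0804.1554v3, Lemma 3.3.2 (tree: `Temkin2013_Lemma332_nft`).

* `isLocalization_O : m° = N[1/f]` as a localization of the integral closure `N` of `k°` in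
  `m` (Temkin's open-immersion lemma `Temkin2013_valuationRingOpen_holds`), `θN : N → D₀`,
  `D₁ = D₀[1/θ₀(f)]`, `θ₁ : m° → D₁` (`IsLocalization.Away.lift`) — PROVED;
* `DHyps` (the largeness of `j` for `W_D`), `lamP₁ : m°[X] → D₁` (`θ₁` on constants,
  `Xᵢ ↦ u′ᵢ`), `βD` = the localized polynomial of `E₀` at `(u′_D, W_D)`, its numerator `bD`,
  and **the roof** `D₂ = D₀[1/(θ₀(f)·b_D)]` (a SINGLE localization of `D₀`; smooth and flat over
  `A″_j`), `θ₂`, `lamP₂`, `WD₂`, `isUnit_βD` — PROVED;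
* the ambient ring `Ω₂ = D₂ ⊗_{A″_j} K` (`ι₂` injective), the comparison `push : Ω_D → Ω₂`,
  `Ξ₂`, `ι₂_θ₂ : ι₂ ∘ θ₂ = Ξ₂`, and **the `D`-side evaluation chain** `ι₂_eval₂_chain`
  (`ι₂(Ψ_O(π^{j_z}u′, w_{D,2})) = ι_{K,2}(Ψ_k(T, w′))`, using (b)) — PROVED;
* `hasMap_WD₂` (`F̃(u′_D, W_D) = 0` by the chain and flat cancellation; the fiat unit `β_D`),
  **`Λ′₀ : E₀ →ₐ[m°[X]] D₂`** (`EtalePair.lift` at `W_{D,2}`), the mirror lemma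
  `ι₂_Λ'₀_aeval_W_Zt` and `Λ'₀_zE` (`Λ′₀` of honest preimages), **(P3)** `Λ′₀ ∘ λ₀ = (A″_j → D₂)`
  (`Λ'₀_lam₀`: generators by `Subring.closure_induction`, then fractions `a/b`, `a, b ∈ A₀`, by
  flat regularity), `Λ'₀_ZE : Λ′₀(Z_E) = Z`, and **`Λ′ : E₁ → D₂`** — PROVED.

All statements are [folklore]; no named facts.

## Sources

* M. Temkin, arXiv:0804.1554v3, proof of Lemma 3.3.2 (pp. 45–46).
-/

noncomputable section

open Polynomial

namespace Literature.AlgebraicGeometry.Resolution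

universe u

variable {k K m : Type u} [Field k] [Field K] [Algebra k K] [Field m] [Algebra k m]

/-! ## The bridge, I: `θ : m° → D₁`, the charts `D₁ ⊆ D₂`, and `Λ′ : E₁ → D₂` -/

namespace DecompChart

variable {V : ValuationSubring k} {O : ValuationSubring m} {A : Subring K}
  {φ : Algebra.adjoin k (A : Set K) →ₐ[k] m} (C : DecompChart V O A φ)

/-! ### `θ` on the integral closure `N` of `k°` in `m`, and `m° = N[1/f]` -/

/-- `N = Nr_m(k°) ⊆ m°` (the integral closure of the image of `k°` in `m`) as an algebra
structure on `m°`. [folklore] -/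
abbrev algNO : Algebra (integralClosure (baseRing m V) m) O :=
  (RingHom.codRestrict ((integralClosure (baseRing m V) m).val.toRingHom) O.toSubring
    fun ν => C.mem_O_of_isIntegral ν.2).toAlgebra

/-- `f ∈ N`. [folklore] -/
def fN : integralClosure (baseRing m V) m := ⟨C.fO, C.fO_isIntegral⟩

/-- **`m° = N[1/f]` as a localization.** [folklore] -/
theorem isLocalization_O : letI := C.algNO; IsLocalization.Away C.fN O := by
  letI := C.algNO
  refine ⟨?_, ?_, ?_⟩
  · rintro ⟨_, n, rfl⟩
    rw [map_pow]
    refine IsUnit.pow _ ⟨⟨⟨C.fO, C.fO_mem⟩, ⟨C.fO⁻¹, C.fO_inv_mem⟩, Subtype.ext (mul_inv_cancel₀ C.fO_ne_zero),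
      Subtype.ext (inv_mul_cancel₀ C.fO_ne_zero)⟩, rfl⟩
  · intro x
    obtain ⟨a, ha, n, hx⟩ := (C.mem_O_iff x).mp x.2
    refine ⟨⟨⟨a, ha⟩, ⟨C.fN ^ n, n, rfl⟩⟩, Subtype.ext ?_⟩
    change (x : m) * ((C.fO ^ n : m)) = a
    rw [hx, div_mul_cancel₀ _ (pow_ne_zero n C.fO_ne_zero)]
  · intro a b h
    refine ⟨1, ?_⟩
    have : (a : m) = b := congrArg (fun y : O => (y : m)) h
    rw [Subtype.ext this]

section Theta

variable (e : ℕ) {j : ℕ} (hj : C.jH ≤ j) (hje : C.bp + e + 2 * C.Na ≤ j)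

/-- **`θ_N : N → D₀`** — integral elements of `m` in the Hensel chart, as a ring homomorphism.
[folklore] -/
def θN : integralClosure (baseRing m V) m →+* C.D₀ e hj hje where
  toFun ν := C.θ₀ e hj hje (show IsIntegral (baseRing m V) (ν : m) from ν.2)
  map_one' := C.ιD_injective e hj hje (by rw [C.ιD_θ₀, OneMemClass.coe_one, map_one, map_one])
  map_mul' a b := by rw [← C.θ₀_mul]
  map_zero' := C.ιD_injective e hj hje (by rw [C.ιD_θ₀, ZeroMemClass.coe_zero, map_zero, map_zero])
  map_add' a b := by rw [← C.θ₀_add]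

/-- `θ_N ν = θ₀ ν`. [folklore] -/
theorem θN_apply (ν : integralClosure (baseRing m V) m) : C.θN e hj hje ν = C.θ₀ e hj hje (show IsIntegral (baseRing m V) (ν : m) from ν.2) :=
  rfl

/-- `θ₀` on `k°`: the structure map. [folklore] -/
theorem θ₀_algebraMap_V (v : V) :
    C.θ₀ e hj hje (isIntegral_algebraMap_of_mem V (m := m) v.2) =
      algebraMap (C.A'' hj) (C.D₀ e hj hje) (C.baseToA'' hj v) :=
  C.ιD_injective e hj hje (by rw [C.ιD_θ₀]; exact C.Ξ_algebraMap_V e hj hje v)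

/-! ### The chart `D₁ = D₀[1/θ₀(f)]` and `θ : m° → D₁` -/

/-- **`D₁ = D₀[1/θ₀(f)]`.** [folklore] -/
abbrev D₁ : Type u := Localization.Away (C.θ₀ e hj hje C.fO_isIntegral)

/-- **`θ : m° → D₁`** — the `m`-side structure of the Hensel chart (`m° = N[1/f]`). [folklore] -/
def θ₁ : O →+* C.D₁ e hj hje :=
  letI := C.algNO
  haveI := C.isLocalization_O
  IsLocalization.Away.lift (S := O) C.fN
    (g := (algebraMap (C.D₀ e hj hje) (C.D₁ e hj hje)).comp (C.θN e hj hje))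
    (by
      change IsUnit (algebraMap (C.D₀ e hj hje) (C.D₁ e hj hje) (C.θ₀ e hj hje C.fO_isIntegral))
      exact IsLocalization.Away.algebraMap_isUnit (C.θ₀ e hj hje C.fO_isIntegral))

/-- `θ` on integral elements: `θ₀`. [folklore] -/
theorem θ₁_of_isIntegral {ν : m} (hν : IsIntegral (baseRing m V) ν) :
    C.θ₁ e hj hje ⟨ν, C.mem_O_of_isIntegral hν⟩ =
      algebraMap (C.D₀ e hj hje) (C.D₁ e hj hje) (C.θ₀ e hj hje hν) := by
  letI := C.algNO
  haveI := C.isLocalization_O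
  rw [show (⟨ν, C.mem_O_of_isIntegral hν⟩ : O) =
    algebraMap (integralClosure (baseRing m V) m) O ⟨ν, hν⟩ from rfl, θ₁, IsLocalization.Away.lift_eq]
  rfl

/-- `θ` on `k°`: the structure map. [folklore] -/
theorem θ₁_vO (v : V) : C.θ₁ e hj hje (C.vO v) =
    algebraMap (C.A'' hj) (C.D₁ e hj hje) (C.baseToA'' hj v) := by
  rw [show C.vO v = ⟨algebraMap k m v, C.mem_O_of_isIntegral (isIntegral_algebraMap_of_mem V (m := m) v.2)⟩
    from rfl, C.θ₁_of_isIntegral e hj hje (isIntegral_algebraMap_of_mem V (m := m) v.2),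
    C.θ₀_algebraMap_V, ← IsScalarTower.algebraMap_apply]

/-- `θ(π) = π`. [folklore] -/
theorem θ₁_πO : C.θ₁ e hj hje C.πO = algebraMap (C.A'' hj) (C.D₁ e hj hje) (C.πS hj) :=
  C.θ₁_vO e hj hje ⟨C.π, C.hπV⟩

/-- `θ(y₀) = ζ`. [folklore] -/
theorem θ₁_y₀O : C.θ₁ e hj hje C.y₀O = algebraMap (C.D₀ e hj hje) (C.D₁ e hj hje) (C.ζ e hj hje) := by
  rw [show C.y₀O = ⟨C.y₀, C.mem_O_of_isIntegral C.y₀_isIntegral⟩ from rfl,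
    C.θ₁_of_isIntegral e hj hje C.y₀_isIntegral, C.θ₀_y₀]

/-- `θ(ι₀) = θ₀(ι₀)`. [folklore] -/
theorem θ₁_ι₀O : C.θ₁ e hj hje C.ι₀O =
    algebraMap (C.D₀ e hj hje) (C.D₁ e hj hje) (C.θ₀ e hj hje C.ι₀_isIntegral) := by
  rw [show C.ι₀O = ⟨C.ι₀, C.mem_O_of_isIntegral C.ι₀_isIntegral⟩ from rfl,
    C.θ₁_of_isIntegral e hj hje C.ι₀_isIntegral]

/-- `θ(c₀′) θ₀(ι₀) = π^{N₀}`. [folklore] -/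
theorem θ₁_c₀'_mul : C.θ₁ e hj hje C.c₀' * C.θ₁ e hj hje C.ι₀O =
    algebraMap (C.A'' hj) (C.D₁ e hj hje) (C.πS hj) ^ C.N₀ := by
  rw [← map_mul, C.c₀'_mul_ι₀O, map_pow, C.θ₁_πO]

end Theta

/-! ### The coordinates of the polydisc chart inside `D₁` and the fiat unit `β_D` -/

section Beta

variable (ε : C.EParams) {e j : ℕ}

/-- The hypotheses of the bridge: those of `EHyps` and the largeness of `j` needed for the
Newton coordinate `W_D`. [folklore] -/
structure DHyps (ε : C.EParams) (e j : ℕ) : Prop extends C.EHyps ε e j where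
  hBw : C.Bw ≤ j
  hjW : C.Bw + (C.N₀ + ε.r + C.dΘ) ≤ j

variable (H : C.DHyps ε e j)

/-- The structure map `m°[X₁,…,X_n] → D₁`: `θ` on constants, `Xᵢ ↦ u′ᵢ`. [folklore] -/
def lamP₁ : MvPolynomial (Fin C.n) O →+* C.D₁ e H.hj H.hje :=
  MvPolynomial.eval₂Hom (C.θ₁ e H.hj H.hje)
    fun i => algebraMap (C.A'' H.hj) (C.D₁ e H.hj H.hje) (C.uD H.hj i)

/-- The Newton coordinate in `D₁`. [folklore] -/
def WD₁ : C.D₁ e H.hj H.hje :=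
  algebraMap (C.D₀ e H.hj H.hje) (C.D₁ e H.hj H.hje) (C.WD e H.hj H.hje H.hBw ε.r)

/-- **The fiat unit `β_D`**: the localized polynomial of the polydisc chart evaluated at
`(u′, W_D)` in `D₁`. [folklore] -/
def βD : C.D₁ e H.hj H.hje := Polynomial.eval₂ (C.lamP₁ ε H) (C.WD₁ ε H) (C.PE ε).g

/-- A numerator of `β_D`: `β_D · θ₀(f)^{n_D} = b_D` with `b_D ∈ D₀`. [folklore] -/
theorem exists_bD : ∃ (b : C.D₀ e H.hj H.hje) (n : ℕ),
    C.βD ε H * algebraMap (C.D₀ e H.hj H.hje) (C.D₁ e H.hj H.hje) (C.θ₀ e H.hj H.hje C.fO_isIntegral) ^ n =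
      algebraMap (C.D₀ e H.hj H.hje) (C.D₁ e H.hj H.hje) b := by
  obtain ⟨⟨b, ⟨_, n, rfl⟩⟩, h⟩ := IsLocalization.surj (Submonoid.powers (C.θ₀ e H.hj H.hje C.fO_isIntegral)) (C.βD ε H)
  exact ⟨b, n, by rw [← map_pow]; exact h⟩

/-- `b_D`. [folklore] -/
def bD : C.D₀ e H.hj H.hje := (C.exists_bD ε H).choose

/-- `n_D`. [folklore] -/
def nD : ℕ := (C.exists_bD ε H).choose_spec.choose

/-- `β_D θ₀(f)^{n_D} = b_D`. [folklore] -/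
theorem bD_spec : C.βD ε H * algebraMap (C.D₀ e H.hj H.hje) (C.D₁ e H.hj H.hje) (C.θ₀ e H.hj H.hje C.fO_isIntegral) ^ C.nD ε H =
    algebraMap (C.D₀ e H.hj H.hje) (C.D₁ e H.hj H.hje) (C.bD ε H) := (C.exists_bD ε H).choose_spec.choose_spec

/-- The element `θ₀(f) · b_D ∈ D₀` to be inverted. [folklore] -/
def dfin : C.D₀ e H.hj H.hje := C.θ₀ e H.hj H.hje C.fO_isIntegral * C.bD ε H

/-- **The common smooth roof** `D₂ = D₀[1/(θ₀(f) b_D)] = D₁[1/β_D]` (before identification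
with `E₁`). [folklore] -/
abbrev D₂ : Type u := Localization.Away (C.dfin ε H)

/-- `θ₀(f)` is a unit of `D₂`. [folklore] -/
theorem isUnit_θ₀f_D₂ : IsUnit (algebraMap (C.D₀ e H.hj H.hje) (C.D₂ ε H) (C.θ₀ e H.hj H.hje C.fO_isIntegral)) :=
  isUnit_of_dvd_unit (map_dvd _ (Dvd.intro _ rfl)) (IsLocalization.Away.algebraMap_isUnit (C.dfin ε H))

/-- `b_D` is a unit of `D₂`. [folklore] -/
theorem isUnit_bD_D₂ : IsUnit (algebraMap (C.D₀ e H.hj H.hje) (C.D₂ ε H) (C.bD ε H)) :=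
  isUnit_of_dvd_unit (map_dvd _ (Dvd.intro_left _ rfl)) (IsLocalization.Away.algebraMap_isUnit (C.dfin ε H))

/-- `D₁ → D₂`. [folklore] -/
def D₁toD₂ : C.D₁ e H.hj H.hje →+* C.D₂ ε H :=
  IsLocalization.Away.lift (C.θ₀ e H.hj H.hje C.fO_isIntegral) (g := algebraMap (C.D₀ e H.hj H.hje) (C.D₂ ε H))
    (C.isUnit_θ₀f_D₂ ε H)

/-- `D₂` as a `D₁`-algebra. [folklore] -/
instance algebraD₁D₂ : Algebra (C.D₁ e H.hj H.hje) (C.D₂ ε H) := (C.D₁toD₂ ε H).toAlgebra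

/-- The structure map `D₁ → D₂` is `D₁toD₂`. [folklore] -/
theorem algebraMap_D₁D₂ : algebraMap (C.D₁ e H.hj H.hje) (C.D₂ ε H) = C.D₁toD₂ ε H := rfl

/-- The tower `D₀ → D₁ → D₂`. [folklore] -/
instance isScalarTower_D₀D₁D₂ : IsScalarTower (C.D₀ e H.hj H.hje) (C.D₁ e H.hj H.hje) (C.D₂ ε H) :=
  IsScalarTower.of_algebraMap_eq fun x => by
    rw [algebraMap_D₁D₂, D₁toD₂, IsLocalization.Away.lift_eq]

/-- The tower `A″_j → D₁ → D₂`. [folklore] -/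
instance isScalarTower_AD₁D₂ : IsScalarTower (C.A'' H.hj) (C.D₁ e H.hj H.hje) (C.D₂ ε H) :=
  IsScalarTower.of_algebraMap_eq fun x => by
    rw [IsScalarTower.algebraMap_apply (C.A'' H.hj) (C.D₀ e H.hj H.hje) (C.D₁ e H.hj H.hje),
      ← IsScalarTower.algebraMap_apply (C.D₀ e H.hj H.hje) (C.D₁ e H.hj H.hje) (C.D₂ ε H),
      ← IsScalarTower.algebraMap_apply]

/-- `D₂` is smooth over `A″_j`. [folklore] -/
instance smooth_D₂ : Algebra.Smooth (C.A'' H.hj) (C.D₂ ε H) := by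
  haveI : Algebra.Smooth (C.D₀ e H.hj H.hje) (C.D₂ ε H) := Algebra.Smooth.of_isLocalization_Away (C.dfin ε H)
  exact Algebra.Smooth.comp (C.A'' H.hj) (C.D₀ e H.hj H.hje) (C.D₂ ε H)

/-- `D₂` is flat over `A″_j`. [folklore] -/
instance flat_D₂ : Module.Flat (C.A'' H.hj) (C.D₂ ε H) := Module.Flat.trans (C.A'' H.hj) (C.D₀ e H.hj H.hje) _

/-- `θ₂ : m° → D₂`. [folklore] -/
def θ₂ : O →+* C.D₂ ε H := (algebraMap (C.D₁ e H.hj H.hje) (C.D₂ ε H)).comp (C.θ₁ e H.hj H.hje)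

/-- The structure map `m°[X₁,…,X_n] → D₂`. [folklore] -/
def lamP₂ : MvPolynomial (Fin C.n) O →+* C.D₂ ε H :=
  (algebraMap (C.D₁ e H.hj H.hje) (C.D₂ ε H)).comp (C.lamP₁ ε H)

/-- `lamP₂` on constants. [folklore] -/
@[simp] theorem lamP₂_C (a : O) : C.lamP₂ ε H (MvPolynomial.C a) = C.θ₂ ε H a := by
  rw [lamP₂, RingHom.comp_apply, lamP₁, MvPolynomial.eval₂Hom_C]; rfl

/-- `lamP₂` on variables. [folklore] -/
@[simp] theorem lamP₂_X (i : Fin C.n) :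
    C.lamP₂ ε H (MvPolynomial.X i) = algebraMap (C.A'' H.hj) (C.D₂ ε H) (C.uD H.hj i) := by
  rw [lamP₂, RingHom.comp_apply, lamP₁, MvPolynomial.eval₂Hom_X', ← IsScalarTower.algebraMap_apply]

/-- The Newton coordinate in `D₂`. [folklore] -/
def WD₂ : C.D₂ ε H := algebraMap (C.D₁ e H.hj H.hje) (C.D₂ ε H) (C.WD₁ ε H)

/-- `W_{D,2}` is the image of `W_D`. [folklore] -/
theorem WD₂_eq : C.WD₂ ε H = algebraMap (C.D₀ e H.hj H.hje) (C.D₂ ε H) (C.WD e H.hj H.hje H.hBw ε.r) := by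
  rw [WD₂, WD₁, ← IsScalarTower.algebraMap_apply]

/-- `D₂` as an `m°[X₁,…,X_n]`-algebra (through `lamP₂`). [folklore] -/
instance algPD₂ : Algebra (MvPolynomial (Fin C.n) O) (C.D₂ ε H) := (C.lamP₂ ε H).toAlgebra

/-- The structure map of `D₂` over `m°[X]` is `lamP₂`. [folklore] -/
theorem algebraMap_PD₂ : algebraMap (MvPolynomial (Fin C.n) O) (C.D₂ ε H) = C.lamP₂ ε H := rfl

/-- Evaluation along `lamP₂` at `W_{D,2}` extends evaluation along `lamP₁` at `W_{D,1}`. [folklore] -/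
theorem eval₂_lamP₂ (q : (MvPolynomial (Fin C.n) O)[X]) :
    Polynomial.eval₂ (C.lamP₂ ε H) (C.WD₂ ε H) q =
      algebraMap (C.D₁ e H.hj H.hje) (C.D₂ ε H) (Polynomial.eval₂ (C.lamP₁ ε H) (C.WD₁ ε H) q) := by
  rw [lamP₂, WD₂, Polynomial.hom_eval₂]

/-- `β_D` is a unit of `D₂`. [folklore] -/
theorem isUnit_βD : IsUnit (Polynomial.eval₂ (C.lamP₂ ε H) (C.WD₂ ε H) (C.PE ε).g) := by
  rw [C.eval₂_lamP₂, ← βD]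
  have h := congrArg (algebraMap (C.D₁ e H.hj H.hje) (C.D₂ ε H)) (C.bD_spec ε H)
  rw [map_mul, map_pow, ← IsScalarTower.algebraMap_apply, ← IsScalarTower.algebraMap_apply] at h
  obtain ⟨u, hu⟩ := (C.isUnit_θ₀f_D₂ ε H).pow (C.nD ε H)
  rw [← hu] at h
  have : algebraMap (C.D₁ e H.hj H.hje) (C.D₂ ε H) (C.βD ε H) = algebraMap (C.D₀ e H.hj H.hje) (C.D₂ ε H) (C.bD ε H) * ↑u⁻¹ := by
    rw [← h, mul_assoc, Units.mul_inv, mul_one]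
  rw [this]
  exact (C.isUnit_bD_D₂ ε H).mul (Units.isUnit _)

/-! ### The ambient ring `Ω₂ = D₂ ⊗_{A″_j} K` and transport from `Ω_D` -/

/-- `Ω₂ = D₂ ⊗_{A″_j} K`. [folklore] -/
abbrev Ω₂ : Type u := TensorProduct (C.A'' H.hj) (C.D₂ ε H) K

/-- `ι₂ : D₂ → Ω₂` (as a ring homomorphism). [folklore] -/
abbrev ι₂ : C.D₂ ε H →+* C.Ω₂ ε H :=
  (Algebra.TensorProduct.includeLeft : C.D₂ ε H →ₐ[C.A'' H.hj] C.Ω₂ ε H).toRingHom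

/-- `ι_{K,2} : K → Ω₂` (as a ring homomorphism). [folklore] -/
abbrev ιK₂ : K →+* C.Ω₂ ε H :=
  (Algebra.TensorProduct.includeRight : K →ₐ[C.A'' H.hj] C.Ω₂ ε H).toRingHom

/-- `ι₂` is injective (`D₂` is flat over the domain `A″_j`). [folklore] -/
theorem ι₂_injective : Function.Injective (C.ι₂ ε H) :=
  Algebra.TensorProduct.includeLeft_injective (S := C.A'' H.hj) Subtype.val_injective

/-- `ι_{K,2} ∘ (A″_j ⊆ K) = ι₂ ∘ (A″_j → D₂)`. [folklore] -/
theorem ιK₂_coe (a : C.A'' H.hj) :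
    C.ιK₂ ε H (a : K) = C.ι₂ ε H (algebraMap (C.A'' H.hj) (C.D₂ ε H) a) := by
  change (Algebra.TensorProduct.includeRight : K →ₐ[C.A'' H.hj] C.Ω₂ ε H) (algebraMap (C.A'' H.hj) K a) =
    (Algebra.TensorProduct.includeLeft : C.D₂ ε H →ₐ[C.A'' H.hj] C.Ω₂ ε H) (algebraMap (C.A'' H.hj) (C.D₂ ε H) a)
  rw [AlgHom.commutes, AlgHom.commutes]

/-- The comparison `Ω_D → Ω₂` (base change of `D₀ → D₂`). [folklore] -/
def push : C.ΩD e H.hj H.hje →+* C.Ω₂ ε H :=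
  (Algebra.TensorProduct.map (IsScalarTower.toAlgHom (C.A'' H.hj) (C.D₀ e H.hj H.hje) (C.D₂ ε H))
    (AlgHom.id (C.A'' H.hj) K)).toRingHom

/-- `push ∘ ι_D = ι₂ ∘ (D₀ → D₂)`. [folklore] -/
@[simp] theorem push_ιD (d : C.D₀ e H.hj H.hje) :
    C.push ε H (C.ιD e H.hj H.hje d) = C.ι₂ ε H (algebraMap (C.D₀ e H.hj H.hje) (C.D₂ ε H) d) := by
  change Algebra.TensorProduct.map _ _ (d ⊗ₜ[C.A'' H.hj] (1 : K)) = _ ⊗ₜ[C.A'' H.hj] (1 : K)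
  rw [Algebra.TensorProduct.map_tmul]; rfl

/-- `push ∘ ι_K = ι_{K,2}`. [folklore] -/
@[simp] theorem push_ιK (x : K) : C.push ε H (C.ιK e H.hj H.hje x) = C.ιK₂ ε H x := by
  change Algebra.TensorProduct.map _ _ ((1 : C.D₀ e H.hj H.hje) ⊗ₜ[C.A'' H.hj] x) = (1 : C.D₂ ε H) ⊗ₜ[C.A'' H.hj] x
  rw [Algebra.TensorProduct.map_tmul, map_one]; rfl

/-- `Ξ₂ = push ∘ Ξ : m → Ω₂`. [folklore] -/
def Ξ₂ : m →+* C.Ω₂ ε H := (C.push ε H).comp (C.Ξ e H.hj H.hje)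

/-- `Ξ₂ = push ∘ Ξ`. [folklore] -/
theorem Ξ₂_apply (a : m) : C.Ξ₂ ε H a = C.push ε H (C.Ξ e H.hj H.hje a) := rfl

/-- `Ξ₂` on `k`. [folklore] -/
theorem Ξ₂_algebraMap (c : k) : C.Ξ₂ ε H (algebraMap k m c) = C.ιK₂ ε H (algebraMap k K c) := by
  rw [Ξ₂_apply, C.Ξ_algebraMap, push_ιK]

/-- Nonzero elements of `m` are units of `Ω₂`. [folklore] -/
theorem isUnit_Ξ₂ {a : m} (ha : a ≠ 0) : IsUnit (C.Ξ₂ ε H a) := (IsUnit.mk0 a ha).map _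

/-- `ι₂ ∘ θ₂ = Ξ₂` on `m°`. [folklore] -/
theorem ι₂_θ₂ (a : O) : C.ι₂ ε H (C.θ₂ ε H a) = C.Ξ₂ ε H a := by
  letI := C.algNO
  haveI := C.isLocalization_O
  suffices h : ((C.ι₂ ε H).comp (C.θ₂ ε H)) = (C.Ξ₂ ε H).comp O.subtype from
    RingHom.congr_fun h a
  refine IsLocalization.ringHom_ext (S := O) (P := C.Ω₂ ε H) (Submonoid.powers C.fN) ?_
  ext ν
  change C.ι₂ ε H (C.θ₂ ε H ⟨ν, C.mem_O_of_isIntegral ν.2⟩) = C.Ξ₂ ε H (ν : m)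
  rw [θ₂, RingHom.comp_apply, C.θ₁_of_isIntegral e H.hj H.hje ν.2, ← IsScalarTower.algebraMap_apply,
    ← push_ιD, C.ιD_θ₀]; rfl

/-- `ι₂(θ₂(π)) = Ξ₂(π)`, through `A″_j`. [folklore] -/
theorem ι₂_algebraMap_πS : C.ι₂ ε H (algebraMap (C.A'' H.hj) (C.D₂ ε H) (C.πS H.hj)) =
    C.Ξ₂ ε H (algebraMap k m C.π) := by
  rw [← ιK₂_coe, C.Ξ₂_algebraMap]; rfl

/-- `ι₂(ζ) = Ξ₂(y₀)`. [folklore] -/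
theorem ι₂_ζ : C.ι₂ ε H (algebraMap (C.D₀ e H.hj H.hje) (C.D₂ ε H) (C.ζ e H.hj H.hje)) = C.Ξ₂ ε H C.y₀ := by
  rw [← push_ιD, ← C.Ξ_y₀]; rfl

/-- **(b) in `Ω₂`**: `π^r Ξ₂(c₀′) ι₂(W_{D,2}) = ι_{K,2}(w′) − Ξ₂(w₀′)`. [folklore] -/
theorem ι₂_WD₂ : C.Ξ₂ ε H (algebraMap k m C.π) ^ ε.r * C.Ξ₂ ε H C.c₀' * C.ι₂ ε H (C.WD₂ ε H) =
    C.ιK₂ ε H (C.w' : K) - C.Ξ₂ ε H C.w₀' := by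
  have h := congrArg (C.push ε H) (C.ιD_WD e H.hj H.hje H.hBw ε.r H.hjW)
  rw [map_mul, map_mul, map_pow, map_sub, push_ιD, push_ιK, ← WD₂_eq] at h
  exact h

/-- The generator in `D₂`: `w_{D,2} = θ₂(w₀′) + θ₂(c₀′π^r) W_{D,2}`. [folklore] -/
def wD₂ : C.D₂ ε H := Polynomial.eval₂ (C.lamP₂ ε H) (C.WD₂ ε H) (C.lin ε)

/-- `w_{D,2}` explicitly. [folklore] -/
theorem wD₂_eq : C.wD₂ ε H = C.θ₂ ε H C.w₀'O + C.θ₂ ε H (C.c₀' * C.πO ^ ε.r) * C.WD₂ ε H := by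
  rw [wD₂, lin, Polynomial.eval₂_add, Polynomial.eval₂_mul, Polynomial.eval₂_C, Polynomial.eval₂_C,
    Polynomial.eval₂_X, lamP₂_C, lamP₂_C]

/-- **`ι₂(w_{D,2}) = ι_{K,2}(w′)`**: the two images of the generator agree in `Ω₂`. [folklore] -/
theorem ι₂_wD₂ : C.ι₂ ε H (C.wD₂ ε H) = C.ιK₂ ε H (C.w' : K) := by
  rw [wD₂_eq, map_add, map_mul, ι₂_θ₂, ι₂_θ₂, MulMemClass.coe_mul, SubmonoidClass.coe_pow, map_mul, map_pow,
    coe_πO, show ((C.w₀'O : O) : m) = C.w₀' from rfl]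
  have h := C.ι₂_WD₂ ε H
  calc _ = C.Ξ₂ ε H C.w₀' + C.Ξ₂ ε H (algebraMap k m C.π) ^ ε.r * C.Ξ₂ ε H C.c₀' * C.ι₂ ε H (C.WD₂ ε H) := by
        ring
    _ = _ := by rw [h]; ring

/-! ### The `D`-side evaluation chain -/

/-- `Tᵢ ∈ A″_j` in zoomed form: `T_S i = π^{j_z} u′ᵢ`. [folklore] -/
def TS (i : Fin C.n) : C.A'' H.hj := C.πS H.hj ^ ε.jz * C.uD H.hj i

/-- `(T_S i : K) = Tᵢ`. [folklore] -/
theorem coe_TS (i : Fin C.n) : ((C.TS ε H i : C.A'' H.hj) : K) = C.T i := by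
  rw [TS, Subring.coe_mul, SubmonoidClass.coe_pow]; exact C.πK_pow_mul_uD H.hj ε.jz H.hjc i

/-- The evaluation `k°[X₁,…,X_n] → A″_j`, `Xᵢ ↦ Tᵢ`. [folklore] -/
def evT : MvPolynomial (Fin C.n) V →+* C.A'' H.hj :=
  MvPolynomial.eval₂Hom (C.baseToA'' H.hj) fun i => C.TS ε H i

/-- The coefficient homomorphism of the `D`-side chain is `(A″_j → D₂) ∘ evT`. [folklore] -/
theorem lamP₂_comp_zoom : (C.lamP₂ ε H).comp ((Polydisc.zoomX (C.πO ^ ε.jz)).toRingHom.comp (MvPolynomial.map C.vO)) =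
    (algebraMap (C.A'' H.hj) (C.D₂ ε H)).comp (C.evT ε H) := by
  refine MvPolynomial.ringHom_ext (fun v => ?_) (fun i => ?_)
  · simp only [RingHom.coe_comp, Function.comp_apply, MvPolynomial.map_C, AlgHom.toRingHom_eq_coe,
      RingHom.coe_coe, Polydisc.zoomX_C, lamP₂_C, evT, MvPolynomial.eval₂Hom_C]
    rw [θ₂, RingHom.comp_apply, C.θ₁_vO, ← IsScalarTower.algebraMap_apply]
  · simp only [RingHom.coe_comp, Function.comp_apply, MvPolynomial.map_X, AlgHom.toRingHom_eq_coe,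
      RingHom.coe_coe, Polydisc.zoomX_X, map_mul, lamP₂_C, lamP₂_X, evT, MvPolynomial.eval₂Hom_X', TS,
      map_pow]
    rw [θ₂, RingHom.comp_apply, C.θ₁_πO, ← IsScalarTower.algebraMap_apply]

/-- The `K`-side evaluation of a `k°`-polynomial at `(T, w′)`, through `Rh`. [folklore] -/
theorem coe_aeval_w'_map (ΨV : (MvPolynomial (Fin C.n) V)[X]) :
    ((Polynomial.aeval C.w' (ΨV.map (MvPolynomial.map (algebraMap V k))) : C.Rh) : K) =
      Polynomial.eval₂ ((C.A'' H.hj).subtype.comp (C.evT ε H)) (C.w' : K) ΨV := by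
  have hcomp : ((C.Rh.val : C.Rh →+* K).comp (algebraMap (MvPolynomial (Fin C.n) k) C.Rh)).comp
      (MvPolynomial.map (algebraMap V k)) = (C.A'' H.hj).subtype.comp (C.evT ε H) := by
    refine MvPolynomial.ringHom_ext (fun v => ?_) (fun i => ?_)
    · simp only [RingHom.coe_comp, Function.comp_apply, MvPolynomial.map_C, evT, MvPolynomial.eval₂Hom_C,
        Subring.coe_subtype, baseToA''_apply_coe]
      rw [← MvPolynomial.algebraMap_eq, ← IsScalarTower.algebraMap_apply]; rfl
    · simp only [RingHom.coe_comp, Function.comp_apply, MvPolynomial.map_X, evT, MvPolynomial.eval₂Hom_X',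
        Subring.coe_subtype, coe_TS]
      exact C.algebraMap_X_coe i
  rw [Polynomial.aeval_def, Polynomial.eval₂_map, ← hcomp,
    show ((Polynomial.eval₂ _ C.w' ΨV : C.Rh) : K) = (C.Rh.val : C.Rh →+* K) (Polynomial.eval₂ _ C.w' ΨV) from rfl,
    Polynomial.hom_eval₂, RingHom.comp_assoc]
  rfl

/-- **The `D`-side evaluation chain**: for `Ψ_V` over `k°`,
`ι₂(Ψ_O(π^{j_z}u′, w_{D,2})) = ι_{K,2}(Ψ_k(T, w′))`. [folklore] -/
theorem ι₂_eval₂_chain (ΨV : (MvPolynomial (Fin C.n) V)[X]) :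
    C.ι₂ ε H (Polynomial.eval₂ (C.lamP₂ ε H) (C.WD₂ ε H)
      ((Polydisc.zpoly (C.πO ^ ε.jz) (ΨV.map (MvPolynomial.map C.vO))).comp (C.lin ε))) =
    C.ιK₂ ε H ((Polynomial.aeval C.w' (ΨV.map (MvPolynomial.map (algebraMap V k))) : C.Rh) : K) := by
  rw [Polynomial.eval₂_comp, ← wD₂, Polydisc.zpoly, Polynomial.map_map, Polynomial.eval₂_map,
    C.lamP₂_comp_zoom, Polynomial.hom_eval₂, C.ι₂_wD₂, C.coe_aeval_w'_map, Polynomial.hom_eval₂]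
  congr 1
  ext a
  · simp only [RingHom.coe_comp, Function.comp_apply, Subring.coe_subtype]
    exact (C.ιK₂_coe ε H _).symm
  · simp only [RingHom.coe_comp, Function.comp_apply, Subring.coe_subtype]
    exact (C.ιK₂_coe ε H _).symm

/-! ### `W_{D,2}` is a point of the polydisc pair: `Λ′₀ : E₀ → D₂` -/

/-- Powers of `π` can be cancelled in `D₂` (flat over `A″_j`). [folklore] -/
theorem D₂_cancel_π {n : ℕ} {a b : C.D₂ ε H}
    (h : algebraMap (C.A'' H.hj) (C.D₂ ε H) (C.πS H.hj) ^ n * a =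
      algebraMap (C.A'' H.hj) (C.D₂ ε H) (C.πS H.hj) ^ n * b) : a = b := by
  have hreg : IsSMulRegular (C.D₂ ε H) (algebraMap (C.A'' H.hj) (C.D₂ ε H) (C.πS H.hj ^ n)) :=
    IsSMulRegular.of_flat (isLeftRegular_iff.mp (IsRegular.of_ne_zero (pow_ne_zero n (fun h0 => C.πK_ne_zero
      (congrArg Subtype.val h0)))).left)
  rw [← map_pow] at h
  exact hreg h

/-- `θ₂(c₀′)` can be cancelled in `D₂`. [folklore] -/
theorem D₂_cancel_c₀' {a b : C.D₂ ε H} (h : C.θ₂ ε H C.c₀' * a = C.θ₂ ε H C.c₀' * b) : a = b := by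
  apply C.D₂_cancel_π ε H (n := C.N₀)
  have hπ : algebraMap (C.A'' H.hj) (C.D₂ ε H) (C.πS H.hj) ^ C.N₀ = C.θ₂ ε H C.ι₀O * C.θ₂ ε H C.c₀' := by
    rw [θ₂, RingHom.comp_apply, RingHom.comp_apply, ← map_mul, mul_comm, C.θ₁_c₀'_mul e H.hj H.hje, map_pow,
      ← IsScalarTower.algebraMap_apply]
  rw [hπ, mul_assoc, mul_assoc, h]

/-! ### `Λ′₀ : E₀ → D₂` -/

/-- The evaluation `m°[X][W] → D₂` at `(u′_D, W_{D,2})`. [folklore] -/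
def evD : (MvPolynomial (Fin C.n) O)[X] →+* C.D₂ ε H := Polynomial.eval₂RingHom (C.lamP₂ ε H) (C.WD₂ ε H)

/-- `evD q = q(u′_D, W_{D,2})`. [folklore] -/
theorem evD_apply (q : (MvPolynomial (Fin C.n) O)[X]) :
    C.evD ε H q = Polynomial.eval₂ (C.lamP₂ ε H) (C.WD₂ ε H) q := rfl

/-- `evD` on constants from `m°`. [folklore] -/
theorem evD_C_C (a : O) : C.evD ε H (Polynomial.C (MvPolynomial.C a)) = C.θ₂ ε H a := by
  rw [evD_apply, Polynomial.eval₂_C, lamP₂_C]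

/-- `θ₂(π) = π`. [folklore] -/
theorem θ₂_πO : C.θ₂ ε H C.πO = algebraMap (C.A'' H.hj) (C.D₂ ε H) (C.πS H.hj) := by
  rw [θ₂, RingHom.comp_apply, C.θ₁_πO, ← IsScalarTower.algebraMap_apply]

/-- **`F̃(u′_D, W_{D,2}) = 0`**: the Newton coordinate satisfies the chart equation in `D₂`.
[folklore] -/
theorem evD_Ft : C.evD ε H (C.Ft ε) = 0 := by
  have h := congrArg (C.evD ε H) (C.Ft_spec ε)
  have hR : C.evD ε H ((Polydisc.zpoly (C.πO ^ ε.jz) C.FO).comp (C.lin ε)) = 0 := by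
    apply C.ι₂_injective ε H
    rw [evD_apply, FO, C.ι₂_eval₂_chain ε H, C.map_FV, C.aeval_w'_F₁, ZeroMemClass.coe_zero, map_zero,
      map_zero]
  rw [hR, map_mul, evD_C_C, map_mul, map_pow, map_pow, θ₂_πO] at h
  -- `θ₂(c₀′)² π^r · F̃(W_D) = 0`; cancel
  apply C.D₂_cancel_c₀' ε H
  apply C.D₂_cancel_c₀' ε H
  apply C.D₂_cancel_π ε H (n := ε.r)
  rw [mul_zero, mul_zero, mul_zero]
  linear_combination h

/-- **`W_{D,2}` is a point of the polydisc pair in `D₂`.** [folklore] -/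
theorem hasMap_WD₂ : (C.PE ε).HasMap (C.WD₂ ε H) := by
  exact ⟨C.evD_Ft ε H, C.isUnit_βD ε H⟩

/-- **The bridge map `Λ′₀ : E₀ → D₂`** (`m°[X]`-algebra map with `W ↦ W_{D,2}`). [folklore] -/
def Λ'₀ : C.E₀ ε →ₐ[MvPolynomial (Fin C.n) O] C.D₂ ε H :=
  (C.PE ε).lift (C.WD₂ ε H) (C.hasMap_WD₂ ε H)

/-- `Λ′₀(W) = W_{D,2}`. [folklore] -/
@[simp] theorem Λ'₀_W : C.Λ'₀ ε H (C.W ε) = C.WD₂ ε H := (C.PE ε).lift_X _ _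

/-- `Λ′₀` on `m°[X₁,…,X_n]`. [folklore] -/
@[simp] theorem Λ'₀_algebraMap (q : MvPolynomial (Fin C.n) O) :
    C.Λ'₀ ε H (algebraMap (MvPolynomial (Fin C.n) O) (C.E₀ ε) q) = C.lamP₂ ε H q :=
  ((C.PE ε).lift (C.WD₂ ε H) (C.hasMap_WD₂ ε H)).commutes q

/-- `Λ′₀` on `m°`: `θ₂`. [folklore] -/
@[simp] theorem Λ'₀_algebraMap_O (a : O) : C.Λ'₀ ε H (algebraMap O (C.E₀ ε) a) = C.θ₂ ε H a := by
  rw [IsScalarTower.algebraMap_apply O (MvPolynomial (Fin C.n) O) (C.E₀ ε), Λ'₀_algebraMap,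
    MvPolynomial.algebraMap_eq, lamP₂_C]

/-- `Λ′₀(u′ᵢ) = u′ᵢ`. [folklore] -/
@[simp] theorem Λ'₀_uE (i : Fin C.n) : C.Λ'₀ ε H (C.uE ε i) = algebraMap (C.A'' H.hj) (C.D₂ ε H) (C.uD H.hj i) := by
  rw [uE, Λ'₀_algebraMap, lamP₂_X]

/-- `Λ′₀` of a polynomial in `W`: `evD`. [folklore] -/
theorem Λ'₀_aeval_W (q : (MvPolynomial (Fin C.n) O)[X]) :
    C.Λ'₀ ε H (Polynomial.aeval (C.W ε) q) = C.evD ε H q := by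
  rw [← Polynomial.aeval_algHom_apply, Λ'₀_W, evD_apply, Polynomial.aeval_def, algebraMap_PD₂]

/-! ### `Λ′₀` on the honest preimages: `Λ′₀(zE z) = z` -/

/-- `ι_{K,2}(π) = Ξ₂(π)`. [folklore] -/
theorem ιK₂_algebraMap_π : C.ιK₂ ε H (algebraMap k K C.π) = C.Ξ₂ ε H (algebraMap k m C.π) := by
  rw [C.Ξ₂_algebraMap]

/-- **Mirror of `ιE_aeval_W_Zt`**: `ι₂(Λ′₀(Ž_z(W))) = ι_{K,2}(z) · ι₂(Λ′₀(Ğ(W)))^{N_z}`. [folklore] -/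
theorem ι₂_Λ'₀_aeval_W_Zt (z : C.Rh) (hz : C.φh z ∈ O) (hb : C.repb z ≤ ε.r) :
    C.ι₂ ε H (C.Λ'₀ ε H (Polynomial.aeval (C.W ε) (C.Zt ε z hz))) =
      C.ιK₂ ε H (z : K) * C.ι₂ ε H (C.Λ'₀ ε H (Polynomial.aeval (C.W ε) (C.Gt ε))) ^ C.repN z := by
  -- EQ1: the `K`-side identity, pushed into `Ω₂`
  have EQ1 := congrArg (fun x : C.Rh => C.ιK₂ ε H (x : K)) (C.aeval_w'_repΦ₁ z)
  simp only [MulMemClass.coe_mul, SubmonoidClass.coe_pow, map_mul, map_pow, algebraMap_Rh_coe,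
    ιK₂_algebraMap_π] at EQ1
  rw [← C.map_repΦV, ← C.ι₂_eval₂_chain ε H, ← repΦO, ← C.map_GV, ← C.ι₂_eval₂_chain ε H, ← GO,
    ← evD_apply, ← evD_apply] at EQ1
  -- EQ2, EQ3: the specs of `Ž_z`, `Ğ`, evaluated in `D₂` and pushed into `Ω₂`
  have EQ2 := congrArg (fun q => C.ι₂ ε H (C.evD ε H q)) (C.Zt_spec ε z hz hb)
  simp only [map_mul, map_pow, evD_C_C, ι₂_θ₂, coe_πO, coe_κ₀O] at EQ2
  have EQ3 := congrArg (fun q => C.ι₂ ε H (C.evD ε H q)) (C.Gt_spec ε)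
  simp only [map_mul, map_pow, evD_C_C, ι₂_θ₂, coe_πO, coe_κ₀O] at EQ3
  have EQ3N : (C.Ξ₂ ε H (algebraMap k m C.π) ^ C.Ng) ^ C.repN z * (C.ι₂ ε H (C.evD ε H (C.Gt ε))) ^ C.repN z =
      (C.Ξ₂ ε H C.κ₀) ^ C.repN z *
        (C.ι₂ ε H (C.evD ε H ((Polydisc.zpoly (C.πO ^ ε.jz) C.GO).comp (C.lin ε)))) ^ C.repN z := by
    rw [← mul_pow, ← mul_pow, EQ3]
  -- abbreviations
  rw [C.Λ'₀_aeval_W, C.Λ'₀_aeval_W]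
  set p := C.Ξ₂ ε H (algebraMap k m C.π)
  set κ := C.Ξ₂ ε H C.κ₀
  set P := C.ι₂ ε H (C.evD ε H ((Polydisc.zpoly (C.πO ^ ε.jz) (C.repΦO z)).comp (C.lin ε)))
  set Q := C.ι₂ ε H (C.evD ε H ((Polydisc.zpoly (C.πO ^ ε.jz) C.GO).comp (C.lin ε)))
  set Zw := C.ι₂ ε H (C.evD ε H (C.Zt ε z hz))
  set Gw := C.ι₂ ε H (C.evD ε H (C.Gt ε))
  set s := C.ιK₂ ε H (z : K)
  have hb' : C.repb z = C.repa z + C.repN z * C.Ng := rfl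
  have key : p ^ C.repb z * κ ^ C.repN z * Zw = p ^ C.repb z * κ ^ C.repN z * (s * Gw ^ C.repN z) := by
    rw [hb'] at EQ2 ⊢
    linear_combination κ ^ C.repN z * EQ2 + κ ^ (2 * C.repN z) * EQ1 -
      p ^ C.repa z * s * κ ^ C.repN z * EQ3N
  have hu : IsUnit (p ^ C.repb z * κ ^ C.repN z) :=
    IsUnit.mul ((C.isUnit_Ξ₂ ε H ((_root_.map_ne_zero _).mpr C.hπ0)).pow _)
      ((C.isUnit_Ξ₂ ε H (fun h0 => C.κ₀O_ne_zero (Subtype.ext h0))).pow _)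
  exact hu.mul_left_cancel key

/-- **`Λ′₀(zE z) = z`** for `z ∈ A″_j ∩ Rh` with `z(x) ∈ m°`, `b_z ≤ r`. [folklore] -/
theorem Λ'₀_zE (z : C.Rh) (hz : C.φh z ∈ O) (hb : C.repb z ≤ ε.r) (hzA : (z : K) ∈ C.A'' H.hj) :
    C.Λ'₀ ε H (C.zE ε z hz) = algebraMap (C.A'' H.hj) (C.D₂ ε H) ⟨z, hzA⟩ := by
  apply C.ι₂_injective ε H
  have hG : C.Λ'₀ ε H (Polynomial.aeval (C.W ε) (C.Gt ε)) * C.Λ'₀ ε H ↑((C.GtWu ε)⁻¹) = 1 := by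
    rw [← map_mul, ← coe_GtWu, Units.mul_inv, map_one]
  have hG' : C.ι₂ ε H (C.Λ'₀ ε H (Polynomial.aeval (C.W ε) (C.Gt ε))) * C.ι₂ ε H (C.Λ'₀ ε H ↑((C.GtWu ε)⁻¹)) = 1 := by
    rw [← map_mul, hG, map_one]
  rw [zE, Units.val_pow_eq_pow_val, map_mul, map_pow, map_mul, map_pow, C.ι₂_Λ'₀_aeval_W_Zt ε H z hz hb,
    ← ιK₂_coe]
  have hGN : (C.ι₂ ε H (C.Λ'₀ ε H (Polynomial.aeval (C.W ε) (C.Gt ε))) *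
      C.ι₂ ε H (C.Λ'₀ ε H ↑((C.GtWu ε)⁻¹))) ^ C.repN z = 1 := by
    rw [hG']; exact one_pow _
  calc _ = C.ιK₂ ε H (z : K) * (C.ι₂ ε H (C.Λ'₀ ε H (Polynomial.aeval (C.W ε) (C.Gt ε))) *
      C.ι₂ ε H (C.Λ'₀ ε H ↑((C.GtWu ε)⁻¹))) ^ C.repN z := by ring
    _ = _ := by rw [hGN]; exact mul_one _

/-! ### (P3) The `K`-side agreement `Λ′₀ ∘ λ₀ = (A″_j → D₂)` -/

/-- Agreement on `A₀`. [folklore] -/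
theorem Λ'₀_lam₀_of_mem_A₀ {z : K} (hz : z ∈ C.A₀) :
    C.Λ'₀ ε H (C.lam₀ ε H.toEHyps ⟨z, C.A₀_subset_A'' H.hj hz⟩) =
      algebraMap (C.A'' H.hj) (C.D₂ ε H) ⟨z, C.A₀_subset_A'' H.hj hz⟩ := by
  induction hz using Subring.closure_induction with
  | mem x hx =>
    rcases hx with ⟨c, hc, rfl⟩ | hx
    · -- constants from `k°`
      have h1 : C.lam₀ ε H.toEHyps ⟨algebraMap k K c, C.A₀_subset_A'' H.hj (C.algebraMap_mem_A₀ hc)⟩ =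
          algebraMap O (C.E₀ ε) (C.vO ⟨c, hc⟩) := by
        refine C.lam₀_of_mem_A₀ ε H.toEHyps (C.algebraMap_mem_A₀ hc) ?_
        rw [← C.ιm_coe ε, coe_VtoO, ← ψE_algebraMap_k]; rfl
      rw [h1, Λ'₀_algebraMap_O, θ₂, RingHom.comp_apply, C.θ₁_vO, ← IsScalarTower.algebraMap_apply]; rfl
    · -- generators `f`
      have h1 : C.lam₀ ε H.toEHyps ⟨x, C.A₀_subset_A'' H.hj (C.f_subset_A₀ hx)⟩ =
          C.zE ε ⟨x, C.A₀_subset_Rh (C.f_subset_A₀ hx)⟩ (C.φh_mem_O_of_mem_A₀ (C.f_subset_A₀ hx)) :=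
        C.lam₀_of_mem_A₀ ε H.toEHyps (C.f_subset_A₀ hx) (C.ιE_zE ε _ _ (H.hfr x hx))
      rw [h1, C.Λ'₀_zE ε H _ _ (H.hfr x hx)]
  | zero => rw [show (⟨(0 : K), C.A₀_subset_A'' H.hj C.A₀.zero_mem⟩ : C.A'' H.hj) = 0 from rfl, map_zero, map_zero, map_zero]
  | one => rw [show (⟨(1 : K), C.A₀_subset_A'' H.hj C.A₀.one_mem⟩ : C.A'' H.hj) = 1 from rfl, map_one, map_one, map_one]
  | add x y hx hy ihx ihy =>
    rw [show (⟨x + y, C.A₀_subset_A'' H.hj (C.A₀.add_mem hx hy)⟩ : C.A'' H.hj) =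
      ⟨x, C.A₀_subset_A'' H.hj hx⟩ + ⟨y, C.A₀_subset_A'' H.hj hy⟩ from rfl, map_add, map_add, map_add, ihx, ihy]
  | neg x hx ihx =>
    rw [show (⟨-x, C.A₀_subset_A'' H.hj (C.A₀.neg_mem hx)⟩ : C.A'' H.hj) = -⟨x, C.A₀_subset_A'' H.hj hx⟩ from rfl,
      map_neg, map_neg, map_neg, ihx]
  | mul x y hx hy ihx ihy =>
    rw [show (⟨x * y, C.A₀_subset_A'' H.hj (C.A₀.mul_mem hx hy)⟩ : C.A'' H.hj) =
      ⟨x, C.A₀_subset_A'' H.hj hx⟩ * ⟨y, C.A₀_subset_A'' H.hj hy⟩ from rfl, map_mul, map_mul, map_mul, ihx, ihy]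

/-- Elements of `A` become elements of `A₀` after multiplication by a power of `π`. [folklore] -/
theorem exists_pow_mul_mem_A₀_of_mem_A {a : K} (ha : a ∈ A) : ∃ N : ℕ, C.πK ^ N * a ∈ C.A₀ := by
  obtain ⟨N, hN⟩ := C.hden a (Algebra.subset_adjoin ha)
  exact ⟨N, hN⟩

/-- Nonzero elements of `A″_j` are non-zero-divisors of `D₂`. [folklore] -/
theorem D₂_cancel {b : C.A'' H.hj} (hb : b ≠ 0) {x y : C.D₂ ε H}
    (h : algebraMap (C.A'' H.hj) (C.D₂ ε H) b * x = algebraMap (C.A'' H.hj) (C.D₂ ε H) b * y) : x = y := by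
  have hreg : IsSMulRegular (C.D₂ ε H) (algebraMap (C.A'' H.hj) (C.D₂ ε H) b) :=
    IsSMulRegular.of_flat (isLeftRegular_iff.mp (IsRegular.of_ne_zero hb).left)
  exact hreg h

/-- **(P3) `Λ′₀ ∘ λ₀ = (A″_j → D₂)`**: the composite of the two bridge maps restricted to the
`K`-side base is the structure map (agreement on `A₀`, then on fractions by flatness).
[folklore] -/
theorem Λ'₀_lam₀ (z : C.A'' H.hj) :
    C.Λ'₀ ε H (C.lam₀ ε H.toEHyps z) = algebraMap (C.A'' H.hj) (C.D₂ ε H) z := by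
  obtain ⟨a', ha', b', hb', hz⟩ := C.hfrac (z : K)
  by_cases hb0 : b' = 0
  · have : z = 0 := Subtype.ext (by rw [hz, hb0, div_zero]; rfl)
    rw [this, map_zero, map_zero, map_zero]
  obtain ⟨Na, hNa⟩ := C.exists_pow_mul_mem_A₀_of_mem_A ha'
  obtain ⟨Nb, hNb⟩ := C.exists_pow_mul_mem_A₀_of_mem_A hb'
  -- `a = π^{Na+Nb} a′`, `b = π^{Na+Nb} b′ ∈ A₀`, `z b = a`, `b ≠ 0`
  have haA₀ : C.πK ^ (Na + Nb) * a' ∈ C.A₀ := by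
    rw [add_comm, pow_add, mul_assoc]; exact C.A₀.mul_mem (C.A₀.pow_mem C.πK_mem_A₀ _) hNa
  have hbA₀ : C.πK ^ (Na + Nb) * b' ∈ C.A₀ := by
    rw [pow_add, mul_assoc]; exact C.A₀.mul_mem (C.A₀.pow_mem C.πK_mem_A₀ _) hNb
  set a : C.A'' H.hj := ⟨_, C.A₀_subset_A'' H.hj haA₀⟩
  set b : C.A'' H.hj := ⟨_, C.A₀_subset_A'' H.hj hbA₀⟩
  have hbne : b ≠ 0 := fun h0 => by
    have := congrArg Subtype.val h0
    exact mul_ne_zero (pow_ne_zero _ C.πK_ne_zero) hb0 this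
  have hzb : z * b = a := by
    apply Subtype.ext
    change (z : K) * (C.πK ^ (Na + Nb) * b') = C.πK ^ (Na + Nb) * a'
    rw [hz, mul_left_comm, div_mul_cancel₀ _ hb0]
  have ha := C.Λ'₀_lam₀_of_mem_A₀ ε H haA₀
  have hbb := C.Λ'₀_lam₀_of_mem_A₀ ε H hbA₀
  have h := congrArg (fun w => C.Λ'₀ ε H (C.lam₀ ε H.toEHyps w)) hzb
  simp only [map_mul] at h
  rw [ha, hbb] at h
  change _ = algebraMap (C.A'' H.hj) (C.D₂ ε H) a at h
  rw [← hzb, map_mul] at h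
  apply C.D₂_cancel ε H hbne
  rw [mul_comm, h, mul_comm]

/-- `Λ′₀` as a ring homomorphism composed with `λ₀`. [folklore] -/
theorem Λ'₀_comp_lam₀ : (C.Λ'₀ ε H).toRingHom.comp (C.lam₀ ε H.toEHyps) = algebraMap (C.A'' H.hj) (C.D₂ ε H) :=
  RingHom.ext fun z => C.Λ'₀_lam₀ ε H z

/-! ### `Λ′₀(Z_E) = Z` and the extension `Λ′ : E₁ → D₂` -/

/-- **`Λ′₀(Z_E) = Z`.** [folklore] -/
theorem Λ'₀_ZE : C.Λ'₀ ε H (C.ZE ε H.toEHyps) = algebraMap (C.D₀ e H.hj H.hje) (C.D₂ ε H) (C.Z e H.hj H.hje) := by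
  have h := congrArg (C.Λ'₀ ε H) (C.ZE_spec ε H.toEHyps)
  rw [map_mul, map_mul, map_sub, Λ'₀_algebraMap_O, Λ'₀_algebraMap_O, map_pow, θ₂_πO,
    show C.yE ε = C.lam₀ ε H.toEHyps (C.yS H.hj) from (C.lam₀_yS ε H.toEHyps).symm,
    show C.ιlE ε H.toEHyps = C.lam₀ ε H.toEHyps (C.ιS H.hj) from (C.lam₀_ιS ε H.toEHyps).symm,
    C.Λ'₀_lam₀, C.Λ'₀_lam₀, θ₂, RingHom.comp_apply, C.θ₁_y₀O] at h
  -- the identity in `D₀`: `(ζ − y) ι = π^{e+N_a} Z`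
  have hδι : C.δS e H.hj * C.ιS H.hj = C.πS H.hj ^ (e + C.Na) := by
    apply Subtype.ext
    change C.δ e * C.ι H.hj = C.πK ^ (e + C.Na)
    rw [δ, mul_assoc, C.ay_mul_ι, ← pow_add]
  have hD₀ : (C.ζ e H.hj H.hje - algebraMap (C.A'' H.hj) (C.D₀ e H.hj H.hje) (C.yS H.hj)) *
      algebraMap (C.A'' H.hj) (C.D₀ e H.hj H.hje) (C.ιS H.hj) =
      algebraMap (C.A'' H.hj) (C.D₀ e H.hj H.hje) (C.πS H.hj) ^ (e + C.Na) * C.Z e H.hj H.hje := by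
    rw [ζ, add_sub_cancel_left, mul_right_comm, ← map_mul, hδι, map_pow, mul_comm]
  have hD₂ := congrArg (algebraMap (C.D₀ e H.hj H.hje) (C.D₂ ε H)) hD₀
  rw [map_mul, map_sub, map_mul, map_pow,
    ← IsScalarTower.algebraMap_apply (C.A'' H.hj) (C.D₀ e H.hj H.hje) (C.D₂ ε H) (C.yS H.hj),
    ← IsScalarTower.algebraMap_apply (C.A'' H.hj) (C.D₀ e H.hj H.hje) (C.D₂ ε H) (C.ιS H.hj),
    ← IsScalarTower.algebraMap_apply (C.A'' H.hj) (C.D₀ e H.hj H.hje) (C.D₂ ε H) (C.πS H.hj)] at hD₂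
  -- `θ₁(y₀) ↦ ζ`
  rw [← IsScalarTower.algebraMap_apply (C.D₀ e H.hj H.hje) (C.D₁ e H.hj H.hje) (C.D₂ ε H)] at h
  exact C.D₂_cancel_π ε H (h.trans hD₂)

/-- `Λ′₀(g_{D,λ})` is a unit of `D₂`. [folklore] -/
theorem isUnit_Λ'₀_gDlam : IsUnit (C.Λ'₀ ε H (C.gDlam ε H.toEHyps)) := by
  have h1 : C.Λ'₀ ε H (C.gDlam ε H.toEHyps) =
      algebraMap (C.D₀ e H.hj H.hje) (C.D₂ ε H) (Polynomial.aeval (C.Z e H.hj H.hje) (C.PD e H.hj H.hje).g) := by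
    rw [gDlam, Polynomial.coe_aeval_eq_eval,
      show Polynomial.eval (C.ZE ε H.toEHyps) (((C.PD e H.hj H.hje).g).map (C.lam₀ ε H.toEHyps)) =
        Polynomial.eval₂ (RingHom.id _) (C.ZE ε H.toEHyps) (((C.PD e H.hj H.hje).g).map (C.lam₀ ε H.toEHyps))
        from rfl,
      show C.Λ'₀ ε H (Polynomial.eval₂ _ _ _) = (C.Λ'₀ ε H).toRingHom (Polynomial.eval₂ _ _ _) from rfl,
      Polynomial.hom_eval₂, RingHom.comp_id, Polynomial.eval₂_map, C.Λ'₀_comp_lam₀,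
      show (C.Λ'₀ ε H).toRingHom (C.ZE ε H.toEHyps) = C.Λ'₀ ε H (C.ZE ε H.toEHyps) from rfl, C.Λ'₀_ZE,
      IsScalarTower.algebraMap_eq (C.A'' H.hj) (C.D₀ e H.hj H.hje) (C.D₂ ε H), ← Polynomial.hom_eval₂,
      Polynomial.aeval_def]
  rw [h1]
  exact (C.PD e H.hj H.hje).hasMap_X.2.map _

/-- **The bridge map `Λ′ : E₁ → D₂`.** [folklore] -/
def Λ' : C.E₁ ε H.toEHyps →+* C.D₂ ε H :=
  IsLocalization.Away.lift (C.gDlam ε H.toEHyps) (g := (C.Λ'₀ ε H).toRingHom) (C.isUnit_Λ'₀_gDlam ε H)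

/-- `Λ′` extends `Λ′₀`. [folklore] -/
@[simp] theorem Λ'_algebraMap (x : C.E₀ ε) :
    C.Λ' ε H (algebraMap (C.E₀ ε) (C.E₁ ε H.toEHyps) x) = C.Λ'₀ ε H x :=
  IsLocalization.Away.lift_eq (C.gDlam ε H.toEHyps) (C.isUnit_Λ'₀_gDlam ε H) x

end Beta

end DecompChart

end Literature.AlgebraicGeometry.Resolution
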